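import Summits.Ventures.LatticeQCDFlow.Exactness.IMHCoupledEstimatorEmpiricalBernstein
import Summits.Ventures.LatticeQCDFlow.Exactness.IMHCoupledEstimatorBernsteinUnboundedWeights
import HarnessLib

/-!
# The empirical Bernstein certificate WITHOUT A WEIGHT BOUND: the error bar computed from the replicas' own scatter is honest for
# every flow — `P(|H̄_R − π f| ≥ √(2ℓ(Q̂_R + s)/R) + 2(c − a)ℓ/(3R) + (c − a)(π{w > M} + ρ^k)) ≤ 2e^{−ℓ} + exp(−Rs²/(2(c − a)⁴)) + R·(q{w > M} + ρ^k)`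

HONEST FRAMING: exact (Metropolis-corrected) sampling algorithms for lattice gauge theory;
figures of merit are autocorrelation/cost numbers at stated couplings and volumes; no
continuum-physics claim.

Venture `LatticeQCDFlow` (cell pub-lqcd), topic `Exactness`; FANOUT row 30 (lean-1, GEN-40).  NEW WORK of the cell, general
(standard Borel) state space, EVERY proposal law `q`, EVERY positive normalised weight — no bound on `w`, no moment condition.
GEN-40's `Exactness/IMHCoupledEstimatorEmpiricalBernstein` proved the empirical certificate (radius printed by the run from the replicas'
mean square scatter `Q̂_R` about a declared reference value `θ`) under a BOUNDED weight; `Exactness/IMHCoupledEstimatorBernsteinUnboundedWeights`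
removed the weight bound from the coupling term (`R·P(X_k ≠ X′_k)`, with `P(X_k ≠ X′_k) ≤ q{w > M} + ρ^k` from the practical start,
`ρ = 1 − c₁/max(1, M)`, `c₁ = E_q[min(1, w)]`) and from the bias allowance (the every-start observable rate).  Composing the two:

* §1 **`crnLag_replicas_burnIn_empirical_certificate_everyWeight`** — from ANY initial coupling `ν̂`, about `m_k = (ν̂₂K^k) f`, every window `N`:
  `P(|H̄_R − m_k| ≥ √(2ℓ(Q̂_R + s)/R) + 2(c − a)ℓ/(3R)) ≤ 2e^{−ℓ} + exp(−Rs²/(2(c − a)⁴)) + R·(ν̂K̂^k)(Δᶜ)` — NO HYPOTHESIS ON THE WEIGHT.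
* §2 **`crnLag_replicas_burnIn_empirical_certificate_target_everyWeight`** — the practical start (production run at `x` with `w(x) ≤ M`,
  leading run one update ahead), ABOUT `π f` ITSELF:
  `P(|H̄_R − π f| ≥ √(2ℓ(Q̂_R + s)/R) + 2(c − a)ℓ/(3R) + (c − a)(π{w > M} + ρ^k)) ≤ 2e^{−ℓ} + exp(−Rs²/(2(c − a)⁴)) + R·(q{w > M} + ρ^k)`.
Reading (gauge files): for `R` independent coupled pairs of two exact gauge samplers on one stream of random numbers, the radius
`√(2ℓ(Q̂_R + s)/R) + 2(c − a)ℓ/(3R)` COMPUTED FROM THE SAME RUN certifies the burn-in-free average about `π f` at confidence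
`1 − 2e^{−ℓ} − exp(−Rs²/(2(c − a)⁴)) − R·(q{w > M} + ρ^k)`, up to the bias allowance — FOR EVERY FLOW, however heavy the tails of its weight.
NOT CLAIMED: the sample-variance (U-statistic) form of the empirical Bernstein bound; anything for unbounded `f`.  No `sorry`, no new
definitions, nothing cited as a fact.
-/

noncomputable section

namespace Summit.Ventures.LatticeQCDFlow.Exactness

open MeasureTheory ProbabilityTheory Function Finset Filter
open scoped _root_.ENNReal unitInterval Topology
open Summit.Ventures.LatticeQCDFlow.Scoring

variable {Ω : Type*} [MeasurableSpace Ω] {q : Measure Ω} [IsProbabilityMeasure q] {w : Ω → ℝ}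

section Replicas

variable {Ω' : Type*} {mΩ' : MeasurableSpace Ω'} {μ : Measure Ω'} [IsProbabilityMeasure μ]
  {Z : ℕ → Ω' → (ℕ → Ω × Ω)}

/-! ## §1 From every initial coupling, about `m_k` -/

/-- **THE EMPIRICAL CERTIFICATE FOR THE COUPLED ESTIMATOR FROM EVERY START, EVERY WEIGHT**: `θ ∈ [a, c]` fixed, `ℓ ≥ 0`, `s > 0`, `R ≥ 1`,
every window `N`, `Q̂_R = R⁻¹Σ_j(f(Y_k^{(j)}) − θ)²`, `m_k = (ν̂₂K^k) f`:
`P(|H̄_R − m_k| ≥ √(2ℓ(Q̂_R + s)/R) + 2(c − a)ℓ/(3R)) ≤ 2e^{−ℓ} + exp(−Rs²/(2(c − a)⁴)) + R·(ν̂K̂^k)(Δᶜ)`. [ours] -/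
theorem crnLag_replicas_burnIn_empirical_certificate_everyWeight [MeasurableEq Ω] [Fact (Measurable w)] (hw0 : ∀ y, 0 < w y)
    (Khat : Kernel (Ω × Ω) (Ω × Ω)) [IsMarkovKernel Khat]
    (hK : ∀ z : Ω × Ω, Khat z = (q.prod (volume : Measure unitInterval)).map (fun p : Ω × unitInterval =>
      ((if (p.2 : ℝ) * w z.1 ≤ w p.1 then p.1 else z.1), (if (p.2 : ℝ) * w z.2 ≤ w p.1 then p.1 else z.2))))
    (ν : Measure (Ω × Ω)) [IsProbabilityMeasure ν] {f : Ω → ℝ} (hf : Measurable f) {a c : ℝ} (ha : ∀ x, a ≤ f x)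
    (hc : ∀ x, f x ≤ c) (k N : ℕ) (hZm : ∀ j, Measurable (Z j))
    (hlaw : ∀ j, μ.map (Z j) = Kernel.trajMeasure (X := fun _ : ℕ => Ω × Ω) ν
      (fun n : ℕ => Khat.comap (fun h : (i : ↥(Finset.Iic n)) → Ω × Ω => h ⟨n, Finset.mem_Iic.2 le_rfl⟩)
        (measurable_pi_apply _)))
    (hind : iIndepFun Z μ) {θ : ℝ} (hθ : θ ∈ Set.Icc a c) {ℓ : ℝ} (hℓ : 0 ≤ ℓ) {s : ℝ} (hs : 0 < s) {R : ℕ} (hR : 1 ≤ R) :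
    μ.real {ω | Real.sqrt (2 * ℓ * ((R : ℝ)⁻¹ * ∑ j ∈ range R, (f ((Z j ω k).2) - θ) ^ 2 + s) / R) + 2 * (c - a) * ℓ / (3 * R) ≤
        |(R : ℝ)⁻¹ * ∑ j ∈ range R, (f ((Z j ω k).2) + ∑ n ∈ range N, (f ((Z j ω (k + n)).1) - f ((Z j ω (k + n)).2))) -
          ∫ y, f y ∂((fun m : Measure Ω => m.bind (indepMH q w))^[k] (ν.map Prod.snd))|} ≤
      2 * Real.exp (-ℓ) + Real.exp (-(R * s ^ 2) / (2 * (c - a) ^ 4)) +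
        R * ((fun m : Measure (Ω × Ω) => m.bind Khat)^[k] ν).real (Set.diagonal Ω)ᶜ := by
  have hw : Measurable w := Fact.out
  set mk := ∫ y, f y ∂((fun m : Measure Ω => m.bind (indepMH q w))^[k] (ν.map Prod.snd)) with hmk
  set B : Set Ω' := ⋃ j ∈ range R, {ω | ∑ n ∈ range N, (f ((Z j ω (k + n)).1) - f ((Z j ω (k + n)).2)) ≠ 0} with hB
  set ρ : Ω' → ℝ := fun ω => Real.sqrt (2 * ℓ * ((R : ℝ)⁻¹ * ∑ j ∈ range R, (f ((Z j ω k).2) - θ) ^ 2 + s) / R) +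
    2 * (c - a) * ℓ / (3 * R) with hρ
  -- off `B` the coupled average is the read-out average
  have hsub : {ω | ρ ω ≤
        |(R : ℝ)⁻¹ * ∑ j ∈ range R, (f ((Z j ω k).2) + ∑ n ∈ range N, (f ((Z j ω (k + n)).1) - f ((Z j ω (k + n)).2))) - mk|}
      ⊆ B ∪ {ω | ρ ω ≤ |(R : ℝ)⁻¹ * ∑ j ∈ range R, f ((Z j ω k).2) - mk|} := by
    intro ω hω
    by_cases hωB : ω ∈ B
    · exact Or.inl hωB
    · right
      have hzero : ∀ j ∈ range R, ∑ n ∈ range N, (f ((Z j ω (k + n)).1) - f ((Z j ω (k + n)).2)) = 0 := by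
        intro j hj
        by_contra hne
        exact hωB (Set.mem_biUnion (show j ∈ (range R : Set ℕ) from by exact_mod_cast hj) hne)
      have hsum : ∑ j ∈ range R, (f ((Z j ω k).2) + ∑ n ∈ range N, (f ((Z j ω (k + n)).1) - f ((Z j ω (k + n)).2))) =
          ∑ j ∈ range R, f ((Z j ω k).2) := sum_congr rfl fun j hj => by rw [hzero j hj, add_zero]
      simp only [Set.mem_setOf_eq] at hω ⊢
      rwa [hsum] at hω
  have h1 := crnLag_replicas_some_correction_le_offDiagonal hw hw0 Khat hK ν hf k N hZm hlaw R
  have h2 := crnLag_replicas_readout_empirical_certificate hw0 Khat hK ν hf ha hc k hZm hlaw hind hθ hℓ hs hR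
  calc μ.real {ω | ρ ω ≤
          |(R : ℝ)⁻¹ * ∑ j ∈ range R, (f ((Z j ω k).2) + ∑ n ∈ range N, (f ((Z j ω (k + n)).1) - f ((Z j ω (k + n)).2))) - mk|}
      ≤ μ.real (B ∪ {ω | ρ ω ≤ |(R : ℝ)⁻¹ * ∑ j ∈ range R, f ((Z j ω k).2) - mk|}) := measureReal_mono hsub
    _ ≤ μ.real B + μ.real {ω | ρ ω ≤ |(R : ℝ)⁻¹ * ∑ j ∈ range R, f ((Z j ω k).2) - mk|} := measureReal_union_le _ _
    _ ≤ R * ((fun m : Measure (Ω × Ω) => m.bind Khat)^[k] ν).real (Set.diagonal Ω)ᶜ +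
          (2 * Real.exp (-ℓ) + Real.exp (-(R * s ^ 2) / (2 * (c - a) ^ 4))) := add_le_add h1 h2
    _ = 2 * Real.exp (-ℓ) + Real.exp (-(R * s ^ 2) / (2 * (c - a) ^ 4)) +
          R * ((fun m : Measure (Ω × Ω) => m.bind Khat)^[k] ν).real (Set.diagonal Ω)ᶜ := by ring

/-! ## §2 The practical start, about `π f` -/

/-- **THE EMPIRICAL CERTIFICATE ABOUT `π f` FROM THE PRACTICAL START — EVERY WEIGHT, EVERY PROPOSAL LAW**: standard Borel `Ω`; production
run at `x` with `w(x) ≤ M`, leading run one update ahead (`ν̂_x = K(x, ·)∘(y ↦ (y, x))⁻¹`), `R` independent coupled pairs, window `N`,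
burn-in `k`, `θ ∈ [a, c]` fixed, `ℓ ≥ 0`, `s > 0`, `R ≥ 1`, `ρ = 1 − c₁/max(1, M)`:
`P(|H̄_R − π f| ≥ √(2ℓ(Q̂_R + s)/R) + 2(c − a)ℓ/(3R) + (c − a)(π{M < w} + ρ^k)) ≤ 2e^{−ℓ} + exp(−Rs²/(2(c − a)⁴)) + R·(q{M < w} + ρ^k)`. [ours] -/
theorem crnLag_replicas_burnIn_empirical_certificate_target_everyWeight [StandardBorelSpace Ω] [Nonempty Ω]
    [MeasurableSingletonClass Ω] [MeasurableEq Ω] [Fact (Measurable w)] (hw0 : ∀ y, 0 < w y)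
    [IsProbabilityMeasure (q.withDensity fun y => ENNReal.ofReal (w y))]
    (Khat : Kernel (Ω × Ω) (Ω × Ω)) [IsMarkovKernel Khat]
    (hK : ∀ z : Ω × Ω, Khat z = (q.prod (volume : Measure unitInterval)).map (fun p : Ω × unitInterval =>
      ((if (p.2 : ℝ) * w z.1 ≤ w p.1 then p.1 else z.1), (if (p.2 : ℝ) * w z.2 ≤ w p.1 then p.1 else z.2))))
    (x : Ω) {M : ℝ} (hxM : w x ≤ M) (ν : Measure (Ω × Ω)) [IsProbabilityMeasure ν]
    (hν : ν = (indepMH q w x).map fun y : Ω => (y, x)) {f : Ω → ℝ} (hf : Measurable f) {a c : ℝ} (ha : ∀ y, a ≤ f y)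
    (hc : ∀ y, f y ≤ c) (k N : ℕ) (hZm : ∀ j, Measurable (Z j))
    (hlaw : ∀ j, μ.map (Z j) = Kernel.trajMeasure (X := fun _ : ℕ => Ω × Ω) ν
      (fun n : ℕ => Khat.comap (fun h : (i : ↥(Finset.Iic n)) → Ω × Ω => h ⟨n, Finset.mem_Iic.2 le_rfl⟩)
        (measurable_pi_apply _)))
    (hind : iIndepFun Z μ) {θ : ℝ} (hθ : θ ∈ Set.Icc a c) {ℓ : ℝ} (hℓ : 0 ≤ ℓ) {s : ℝ} (hs : 0 < s) {R : ℕ} (hR : 1 ≤ R) :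
    μ.real {ω | Real.sqrt (2 * ℓ * ((R : ℝ)⁻¹ * ∑ j ∈ range R, (f ((Z j ω k).2) - θ) ^ 2 + s) / R) + 2 * (c - a) * ℓ / (3 * R) +
          (c - a) * ((q.withDensity fun y => ENNReal.ofReal (w y)) {y | M < w y} +
            (1 - (∫⁻ y, ENNReal.ofReal (min 1 (w y)) ∂q) / ENNReal.ofReal (max 1 M)) ^ k).toReal ≤
        |(R : ℝ)⁻¹ * ∑ j ∈ range R, (f ((Z j ω k).2) + ∑ n ∈ range N, (f ((Z j ω (k + n)).1) - f ((Z j ω (k + n)).2))) -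
          ∫ y, f y ∂(q.withDensity fun y => ENNReal.ofReal (w y))|} ≤
      2 * Real.exp (-ℓ) + Real.exp (-(R * s ^ 2) / (2 * (c - a) ^ 4)) +
        R * (q {y | M < w y} + (1 - (∫⁻ y, ENNReal.ofReal (min 1 (w y)) ∂q) / ENNReal.ofReal (max 1 M)) ^ k).toReal := by
  have hw : Measurable w := Fact.out
  have hφ : Measurable fun y : Ω => (y, x) := measurable_id.prodMk measurable_const
  set c₁ := ∫⁻ y, ENNReal.ofReal (min 1 (w y)) ∂q with hc₁
  set r : ℝ≥0∞ := (1 - c₁ / ENNReal.ofReal (max 1 M)) ^ k with hr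
  have hr1 : r ≤ 1 := (pow_le_pow_left' tsub_le_self k).trans_eq (one_pow k)
  have hsnd : ν.map Prod.snd = Measure.dirac x := by
    rw [hν, Measure.map_map measurable_snd hφ]
    have : (Prod.snd ∘ fun y : Ω => (y, x)) = fun _ => x := rfl
    rw [this, Measure.map_const, measure_univ, one_smul]
  set πm : Measure Ω := q.withDensity fun y => ENNReal.ofReal (w y) with hπm
  set mk := ∫ y, f y ∂((fun m : Measure Ω => m.bind (indepMH q w))^[k] (Measure.dirac x)) with hmk
  set πf := ∫ y, f y ∂πm with hπf
  set X : ℕ → Ω' → ℝ := fun j ω => f ((Z j ω k).2) + ∑ n ∈ range N, (f ((Z j ω (k + n)).1) - f ((Z j ω (k + n)).2)) with hX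
  set ρ : Ω' → ℝ := fun ω => Real.sqrt (2 * ℓ * ((R : ℝ)⁻¹ * ∑ j ∈ range R, (f ((Z j ω k).2) - θ) ^ 2 + s) / R) +
    2 * (c - a) * ℓ / (3 * R) with hρ
  have h := crnLag_replicas_burnIn_empirical_certificate_everyWeight hw0 Khat hK ν hf ha hc k N hZm hlaw hind hθ hℓ hs hR
  rw [hsnd] at h
  have hoff : ((fun m : Measure (Ω × Ω) => m.bind Khat)^[k] ν).real (Set.diagonal Ω)ᶜ ≤ (q {y | M < w y} + r).toReal := by
    rw [measureReal_def]
    exact ENNReal.toReal_mono (ENNReal.add_ne_top.2 ⟨measure_ne_top q _, ne_top_of_le_ne_top ENNReal.one_ne_top hr1⟩)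
      (iterate_bind_crnPair_offDiagonal_detLag_le_tail hw hw0 Khat hK x hxM ν hν k)
  have hbias : |mk - πf| ≤ (c - a) * (πm {y | M < w y} + r).toReal := by
    have hb := imh_everyStart_integral_sub_abs_le_tail (q := q) hw hw0 x hf ha hc k M
    rw [max_eq_right hxM, abs_sub_comm] at hb
    exact hb
  have hsub : {ω | ρ ω + (c - a) * (πm {y | M < w y} + r).toReal ≤ |(R : ℝ)⁻¹ * ∑ j ∈ range R, X j ω - πf|} ⊆
      {ω | ρ ω ≤ |(R : ℝ)⁻¹ * ∑ j ∈ range R, X j ω - mk|} := by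
    intro ω hω
    simp only [Set.mem_setOf_eq] at hω ⊢
    have htri : |(R : ℝ)⁻¹ * ∑ j ∈ range R, X j ω - πf| ≤ |(R : ℝ)⁻¹ * ∑ j ∈ range R, X j ω - mk| + |mk - πf| :=
      abs_sub_le ((R : ℝ)⁻¹ * ∑ j ∈ range R, X j ω) mk πf
    linarith
  have hRnn : (0 : ℝ) ≤ R := Nat.cast_nonneg R
  calc μ.real {ω | ρ ω + (c - a) * (πm {y | M < w y} + r).toReal ≤ |(R : ℝ)⁻¹ * ∑ j ∈ range R, X j ω - πf|}
      ≤ μ.real {ω | ρ ω ≤ |(R : ℝ)⁻¹ * ∑ j ∈ range R, X j ω - mk|} := measureReal_mono hsub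
    _ ≤ 2 * Real.exp (-ℓ) + Real.exp (-(R * s ^ 2) / (2 * (c - a) ^ 4)) +
          R * ((fun m : Measure (Ω × Ω) => m.bind Khat)^[k] ν).real (Set.diagonal Ω)ᶜ := h
    _ ≤ 2 * Real.exp (-ℓ) + Real.exp (-(R * s ^ 2) / (2 * (c - a) ^ 4)) + R * (q {y | M < w y} + r).toReal := by gcongr

end Replicas

end Summit.Ventures.LatticeQCDFlow.Exactness

end
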